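import Summits.QuantumFields.GaugeBoot.BootstrapCertificatesZd
import HarnessLib

/-!
# `U(N)` on `ℤ^d`: SOS ⊕ loop-equation certificates bound every Gibbs state, and are complete (gauge-boot, L1/L4 supplement)

HONEST FRAMING (cell `pub-gaugeboot`, page 1 of every file): the venture produces certified bounds
on lattice expectations at stated coupling, gauge group, dimension and torus size; NOT a mass gap,
NOT a continuum limit, NOT a string tension; NOT Yang–Mills-summit-bearing (barriers
`FixedCouplingUltralocality`, `PerturbativeInvisibility`). Structural; it certifies no number.

## Content (the `U(N)` twin of `BootstrapCertificatesZd.lean`; `N = 1` is the abelian case)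

`U(N)` on `ℤ^d`, every `d`, `N`, every real `β`, one-link boundary actions
`S_e = wilsonBoundaryAction ρ {e}`, shifts `e^{tX}`, `X ∈ 𝔲(N)`:

* `isBootstrapFeasible_dlr_uN` — every DLR state is feasible at every level;
* ★★ `dlr_integral_le_of_mem_certCone_uN` — a level-`n` certificate bounds EVERY Gibbs state;
* ★★★ `forall_zdFeasible_apply_le_iff_uN` — no duality gap at each level;
* `bootstrap_convergence_dlr_uN` — the truncated `ℤ^d` bootstrap converges to the DLR values;
* ★★★ `exists_certificate_of_forall_dlr_le_uN` — a polynomial bound strictly valid in ALL Gibbs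
  states is certified at some level; `exists_certificate_of_dlr_lt_uN_of_small` (strong coupling,
  THE state).

References: Kazakov–Zheng arXiv:2203.11360; Li–Zhou arXiv:2404.17071 (abelian); Josz–Henrion
(2016). Folklore.
-/

noncomputable section

open MeasureTheory Filter Topology NormedSpace
open Literature.MathematicalPhysics.QuantumFieldTheory (LatticeRep ymGibbsMeasures_nonempty)
open Literature.MathematicalPhysics.QuantumLattice

namespace Summit.QuantumFields.GaugeBoot

open OrderUnitDuality

section ZdUN

variable {d : ℕ} (N : ℕ) (β : ℝ)

/-- **The level-`n` certificate cone of the `U(N)` bootstrap on `ℤ^d`.** [folklore] -/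
abbrev certConeZdUN (n : ℕ) :
    PointedCone ℝ C(LGConfig d (Matrix.unitaryGroup (Fin N) ℂ), ℝ) :=
  certCone (unitaryFundamentalLatticeRep N) (uExp N)
    (fun e => wilsonBoundaryAction (unitaryFundamentalRep (Fin N) ℂ) {e}) β
    (wordTruncation (ι := ZdEdge d) (unitaryFundamentalLatticeRep N) n)

/-- **The level-`n` certificate domain of the `U(N)` bootstrap on `ℤ^d`.** [folklore] -/
abbrev certDomainZdUN (n : ℕ) :
    Submodule ℝ C(LGConfig d (Matrix.unitaryGroup (Fin N) ℂ), ℝ) :=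
  certDomain (unitaryFundamentalLatticeRep N) (uExp N)
    (fun e => wilsonBoundaryAction (unitaryFundamentalRep (Fin N) ℂ) {e}) β n

/-- **Every `U(N)` DLR state is feasible at every polynomial level.** [folklore] -/
theorem isBootstrapFeasible_dlr_uN {ν : Measure (LGConfig d (Matrix.unitaryGroup (Fin N) ℂ))}
    (hν : ν ∈ ymGibbsMeasures (d := d) (unitaryFundamentalRep (Fin N) ℂ) β)
    {V : Set C(LGConfig d (Matrix.unitaryGroup (Fin N) ℂ), ℝ)}
    (hV : V ⊆ polyAlgebra (ι := ZdEdge d) (unitaryFundamentalLatticeRep N)) :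
    haveI := hν.1
    IsBootstrapFeasible (unitaryFundamentalLatticeRep N) (uExp N)
      (fun e => wilsonBoundaryAction (unitaryFundamentalRep (Fin N) ℂ) {e}) β V
      (expectationFunctional ν) := by
  haveI := hν.1
  exact isBootstrapFeasible_expectationFunctional (unitaryFundamentalLatticeRep N) (uExp_add N)
    (X := fun X : UGenerator N => (X : Matrix (Fin N) (Fin N) ℂ)) (rho_uExp N)
    (fun e => wilsonBoundaryAction_mem_polyFunctions (unitaryFundamentalLatticeRep N) {e}) ν
    ((isPolySchwingerDysonState_iff_mem_ymGibbsMeasures_uN N β ν).2 hν) hV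

/-- The one-link boundary actions have polynomial derivatives along the `𝔲(N)` shifts. -/
theorem wilsonBoundaryAction_polyDeriv_uN (i : ZdEdge d) (a : UGenerator N) :
    ∃ S' ∈ polyAlgebra (ι := ZdEdge d) (unitaryFundamentalLatticeRep N),
      ∀ U : LGConfig d (Matrix.unitaryGroup (Fin N) ℂ),
        HasDerivAt (fun t => wilsonBoundaryAction (unitaryFundamentalRep (Fin N) ℂ) {i}
          (Function.update U i (uExp N a t * U i))) (S' U) 0 :=
  exists_polyDeriv_of_mem_polyFunctions (unitaryFundamentalLatticeRep N)
    (S := fun e => wilsonBoundaryAction (unitaryFundamentalRep (Fin N) ℂ) {e}) (uExp_add N)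
    (X := fun X : UGenerator N => (X : Matrix (Fin N) (Fin N) ℂ)) (rho_uExp N)
    (fun e => wilsonBoundaryAction_mem_polyFunctions (unitaryFundamentalLatticeRep N) {e}) i a

/-- **The level-`n` feasible set of the `U(N)` bootstrap on `ℤ^d` is non-empty.** -/
theorem exists_zdFeasible_uN (n : ℕ) :
    ∃ φ₀ : C(LGConfig d (Matrix.unitaryGroup (Fin N) ℂ), ℝ) →ₗ[ℝ] ℝ,
      IsBootstrapFeasible (unitaryFundamentalLatticeRep N) (uExp N)
        (fun e => wilsonBoundaryAction (unitaryFundamentalRep (Fin N) ℂ) {e}) β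
        (wordTruncation (ι := ZdEdge d) (unitaryFundamentalLatticeRep N) n) φ₀ := by
  obtain ⟨μ, hμ⟩ := ymGibbsMeasures_nonempty (d := d) (unitaryFundamentalRep (Fin N) ℂ)
    (continuous_unitaryFundamentalRep (n := Fin N) (𝕜 := ℂ)) β
  exact ⟨_, isBootstrapFeasible_dlr_uN N β hμ (wordTruncation_subset_polyAlgebra _ n)⟩

/-- ★★ **A level-`n` certificate bounds the expectation of `P` in EVERY `U(N)` Gibbs state.**
[folklore] -/
theorem dlr_integral_le_of_mem_certCone_uN {n : ℕ}
    {P : C(LGConfig d (Matrix.unitaryGroup (Fin N) ℂ), ℝ)} {c : ℝ}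
    (hc : c • (1 : C(LGConfig d (Matrix.unitaryGroup (Fin N) ℂ), ℝ)) - P ∈
      certConeZdUN (d := d) N β n)
    {μ : Measure (LGConfig d (Matrix.unitaryGroup (Fin N) ℂ))}
    (hμ : μ ∈ ymGibbsMeasures (d := d) (unitaryFundamentalRep (Fin N) ℂ) β) :
    ∫ U, P U ∂μ ≤ c := by
  haveI := hμ.1
  have h := (isBootstrapFeasible_dlr_uN N β hμ
    (wordTruncation_subset_polyAlgebra _ n)).apply_le_of_mem_certCone _ hc
  rwa [expectationFunctional_apply] at h

/-- ★★★ **No duality gap for the `U(N)` bootstrap on `ℤ^d`.** [folklore] -/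
theorem forall_zdFeasible_apply_le_iff_uN {n : ℕ}
    {P : C(LGConfig d (Matrix.unitaryGroup (Fin N) ℂ), ℝ)}
    (hP : P ∈ certDomainZdUN (d := d) N β n) {c : ℝ} :
    (∀ φ : C(LGConfig d (Matrix.unitaryGroup (Fin N) ℂ), ℝ) →ₗ[ℝ] ℝ,
      IsBootstrapFeasible (unitaryFundamentalLatticeRep N) (uExp N)
        (fun e => wilsonBoundaryAction (unitaryFundamentalRep (Fin N) ℂ) {e}) β
        (wordTruncation (ι := ZdEdge d) (unitaryFundamentalLatticeRep N) n) φ → φ P ≤ c) ↔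
      ∀ ε : ℝ, 0 < ε → (c + ε) • (1 : C(LGConfig d (Matrix.unitaryGroup (Fin N) ℂ), ℝ))
        - P ∈ certConeZdUN (d := d) N β n :=
  forall_feasible_apply_le_iff (unitaryFundamentalLatticeRep N) (wilsonBoundaryAction_polyDeriv_uN N)
    (exists_zdFeasible_uN N β n) hP

/-- **Convergence of the truncated `U(N)` bootstrap on `ℤ^d`**: level-`n` feasible values are
eventually within `ε` of `{∫ P dμ : μ DLR}`. [folklore] -/
theorem bootstrap_convergence_dlr_uN
    (V : ℕ → Set C(LGConfig d (Matrix.unitaryGroup (Fin N) ℂ), ℝ))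
    (hex : ∀ a ∈ polyAlgebra (ι := ZdEdge d) (unitaryFundamentalLatticeRep N), ∀ᶠ n in atTop, a ∈ V n)
    {P : C(LGConfig d (Matrix.unitaryGroup (Fin N) ℂ), ℝ)}
    (hP : P ∈ polyAlgebra (ι := ZdEdge d) (unitaryFundamentalLatticeRep N)) {ε : ℝ} (hε : 0 < ε) :
    ∃ n, ∀ φ : C(LGConfig d (Matrix.unitaryGroup (Fin N) ℂ), ℝ) →ₗ[ℝ] ℝ,
      IsBootstrapFeasible (unitaryFundamentalLatticeRep N) (uExp N)
          (fun e => wilsonBoundaryAction (unitaryFundamentalRep (Fin N) ℂ) {e}) β (V n) φ →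
        ∃ μ ∈ ymGibbsMeasures (d := d) (unitaryFundamentalRep (Fin N) ℂ) β,
          |φ P - ∫ U, P U ∂μ| ≤ ε := by
  obtain ⟨n, hn⟩ := bootstrap_convergence (unitaryFundamentalLatticeRep N) (uExp_add N)
    (X := fun X : UGenerator N => (X : Matrix (Fin N) (Fin N) ℂ)) (rho_uExp N)
    (fun e => wilsonBoundaryAction_mem_polyFunctions (unitaryFundamentalLatticeRep N) {e}) V hex hP hε
  refine ⟨n, fun φ hφ => ?_⟩
  obtain ⟨ψ, hψ, hclose⟩ := hn φ hφ
  obtain ⟨μ, hμ, hψμ⟩ := exists_dlr_of_bootstrap_uN N β hψ.1 hψ.2.1 hψ.2.2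
  exact ⟨μ, hμ, by rwa [hψμ P hP] at hclose⟩

/-- ★★★ **Every polynomial bound strictly valid in all `U(N)` Gibbs states is certified at some
level.** [folklore] -/
theorem exists_certificate_of_forall_dlr_le_uN
    {P : C(LGConfig d (Matrix.unitaryGroup (Fin N) ℂ), ℝ)}
    (hP : P ∈ polyAlgebra (ι := ZdEdge d) (unitaryFundamentalLatticeRep N)) {c₀ c : ℝ}
    (h : ∀ μ ∈ ymGibbsMeasures (d := d) (unitaryFundamentalRep (Fin N) ℂ) β, ∫ U, P U ∂μ ≤ c₀)
    (hc : c₀ < c) :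
    ∃ n : ℕ, ∃ σ ∈ sosCone (wordTruncation (ι := ZdEdge d) (unitaryFundamentalLatticeRep N) n),
      ∃ ρ ∈ rowSpace (unitaryFundamentalLatticeRep N) (uExp N)
        (fun e => wilsonBoundaryAction (unitaryFundamentalRep (Fin N) ℂ) {e}) β
        (wordTruncation (ι := ZdEdge d) (unitaryFundamentalLatticeRep N) n),
        σ + ρ = c • (1 : C(LGConfig d (Matrix.unitaryGroup (Fin N) ℂ), ℝ)) - P := by
  have hε : 0 < (c - c₀) / 2 := by linarith
  obtain ⟨n₁, hn₁⟩ := bootstrap_convergence_dlr_uN (d := d) N β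
    (fun n => wordTruncation (ι := ZdEdge d) (unitaryFundamentalLatticeRep N) n)
    (fun a ha => eventually_mem_wordTruncation _ ha) hP hε
  obtain ⟨n₂, hn₂⟩ :=
    (eventually_mem_wordTruncation (unitaryFundamentalLatticeRep N) hP).exists_forall_of_atTop
  refine ⟨max n₁ n₂, exists_certificate_of_forall_apply_le (unitaryFundamentalLatticeRep N)
    (wilsonBoundaryAction_polyDeriv_uN N) (exists_zdFeasible_uN N β _)
    (mem_certDomain_of_mem_wordTruncation _ (wordTruncation_mono _
      ((le_max_right n₁ n₂).trans (Nat.le_add_right _ _)) (hn₂ n₂ le_rfl)))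
    (c := c₀ + (c - c₀) / 2) (fun φ hφ => ?_) (by linarith)⟩
  obtain ⟨μ, hμ, hclose⟩ := hn₁ φ (hφ.mono _ (wordTruncation_mono _ (le_max_left n₁ n₂)))
  have h1 := (abs_le.1 hclose).2
  linarith [h μ hμ]

/-- ★★★ **Strong coupling** (`6(d-1)N|β| < 1`, unique DLR state `ν`): every `c > ∫ P dν` has a
certificate at some level (`U(N)` on `ℤ^d`). [folklore] -/
theorem exists_certificate_of_dlr_lt_uN_of_small {β : ℝ}
    (hβ : 6 * ((d - 1 : ℕ) : ℝ) * N * |β| < 1)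
    {ν : Measure (LGConfig d (Matrix.unitaryGroup (Fin N) ℂ))}
    (hν : ν ∈ ymGibbsMeasures (d := d) (unitaryFundamentalRep (Fin N) ℂ) β)
    {P : C(LGConfig d (Matrix.unitaryGroup (Fin N) ℂ), ℝ)}
    (hP : P ∈ polyAlgebra (ι := ZdEdge d) (unitaryFundamentalLatticeRep N)) {c : ℝ}
    (hc : ∫ U, P U ∂ν < c) :
    ∃ n : ℕ, ∃ σ ∈ sosCone (wordTruncation (ι := ZdEdge d) (unitaryFundamentalLatticeRep N) n),
      ∃ ρ ∈ rowSpace (unitaryFundamentalLatticeRep N) (uExp N)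
        (fun e => wilsonBoundaryAction (unitaryFundamentalRep (Fin N) ℂ) {e}) β
        (wordTruncation (ι := ZdEdge d) (unitaryFundamentalLatticeRep N) n),
        σ + ρ = c • (1 : C(LGConfig d (Matrix.unitaryGroup (Fin N) ℂ), ℝ)) - P := by
  refine exists_certificate_of_forall_dlr_le_uN N β hP (c₀ := ∫ U, P U ∂ν) (fun μ hμ => ?_) hc
  rw [subsingleton_ymGibbsMeasures_allGroups (unitaryFundamentalRep (Fin N) ℂ)
    (continuous_unitaryFundamentalRep (n := Fin N) (𝕜 := ℂ)) hβ hμ hν]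

end ZdUN

end Summit.QuantumFields.GaugeBoot

end
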